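import Summits.Ventures.LatticeQCDFlow.Scaling.ReplicaExchangeModeTorpid
import Summits.Ventures.LatticeQCDFlow.Scaling.ReplicaExchangeBareSampler

/-!
HONEST FRAMING: exact (Metropolis-corrected) sampling algorithms for lattice gauge theory; figures
of merit are autocorrelation/cost numbers at stated couplings and volumes; no continuum-physics
claim.

# ExchangeSchemeSectorCeiling — NO EXCHANGE SCHEME WHATSOEVER BEATS THE REPLICAS' OWN TUNNELLING: FOR
# `P = t·Q + (1−t)·Upd` WITH `Q` ANY `π̃`-REVERSIBLE MOVE THAT PRESERVES THE NUMBER OF REPLICAS IN A SECTOR `A`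
# (every swap graph, schedule, multi-replica permutation, sector-preserving map),
# `Gap(P) ≤ (1−t)·Σ_k Q_k(A,Aᶜ)/((K+1)·Σ_k μ_k(A)μ_k(Aᶜ))`; ONE TUNNELLING REPLICA: `Gap(P) ≤ (1−t)Q_0(A,Aᶜ)/((K+1)Kv)`
# (lean-2 GEN-19, ours)

Venture-side (OURS).  Cell `lqcd-flow` (pub-lqcd), unit `pub-lqcd-lean-2-g19`, 2026-08-25.  Chapters R/F/G, the
universal form of the sector-count ceilings (`ReplicaExchangeModeTorpid` §3 for the adjacent ladder,
`ReplicaExchangeGraphSwapDiffusive` §4 for swap graphs with maps).  State space `Fin (K+1) → S`, law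
`π̃ = ⊗_k μ_k` (`tensorFun μ`), replica updates `Upd = prodKernel (1/(K+1)) M` (a uniformly chosen replica `k` makes
one `M_k`-step; `M_k` row-stochastic, `μ_k`-reversible), and an EXCHANGE MOVE `Q`: any row-stochastic
`π̃`-reversible kernel such that `Q(x,y) > 0 ⇒ #{k : y_k ∈ A} = #{k : x_k ∈ A}`.  The sampler is the mixture
`P(x,y) = t·Q(x,y) + (1−t)·Upd(x,y)`.

## What is proved

* §1 (generic) `dirichletForm_mixtureFun`, `dirichletForm_eq_zero_of_invariant`, `isRowStochastic_mixtureFun`,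
  `detailedBalance_mixtureFun`.
* §2 the centred sector count `G_A(x) = Σ_k f_A^{(μ_k)}(x_k)` under `π̃`: `sectorCount_sub_eq` (its increments are
  those of the raw count), `tensorFun_mean_sectorCount` (`= 0`), `tensorFun_piInner_sectorCount`
  (`= Σ_k μ_k(A)μ_k(Aᶜ)`), `prodUpdate_dirichletForm_sectorCount` (`= (1/(K+1))Σ_k Q_k(A,Aᶜ)`),
  `exchange_dirichletForm_sectorCount` (`𝓔_Q(G_A) = 0`), `mixture_dirichletForm_sectorCount`.
* §3 **`exchangeScheme_spectralGap_le_sectorCount`** — the ceiling of the title (`0 ≤ t ≤ 1`, `|S| ≥ 2`,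
  `Σ_k μ_k(A)μ_k(Aᶜ) > 0`); **`exchangeScheme_spectralGap_le_hot`** — sector-frozen cold replicas
  (`Q_k(A,Aᶜ) = 0`, `μ_k(A)μ_k(Aᶜ) ≥ v`, `k ≥ 1`; `K ≥ 1`): `Gap(P) ≤ (1−t)Q_0(A,Aᶜ)/((K+1)·K·v)`.

Reading (no numerics implied): whatever is learned about HOW replicas are exchanged — topology, maps between
neighbouring couplings that respect topological sectors, cluster permutations — the exact sampler over `K`
sector-frozen cold replicas and one tunnelling replica relaxes no faster than `K²` sampler steps (the tunnelling
replica is touched one step in `K+1` and each fresh sector label serves one client); the graph samplers of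
`ReplicaExchangeGraphSwap` and the flow-swap samplers of `ReplicaExchangeFlowSwap` are instances (`Q` = their
swap part).  NOT CLAIMED: schemes whose exchange move itself changes sectors (those are updates, and pay
acceptance: `FlowSwapAcceptanceTwoSided`); anything measured.  Literature grade (cell rule): KNOWN MECHANISM
(test-function ceilings), NEW TYPING (universal over exchange moves); nothing cited as a fact; no new bib keys.
-/

noncomputable section

open Finset Function
open Literature.Probability.MarkovChains

namespace Summit.Ventures.LatticeQCDFlow.Scaling

/-! ## §1 Mixtures of kernels and invariant observables (generic) -/

section Generic

variable {X : Type*} [Fintype X]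

/-- `𝓔_π(tQ + (1−t)U; f) = t·𝓔_π(Q; f) + (1−t)·𝓔_π(U; f)`. [ours] -/
theorem dirichletForm_mixtureFun (π : X → ℝ) (Q U : Matrix X X ℝ) (t : ℝ) (f : X → ℝ) :
    dirichletForm π (fun x y => t * Q x y + (1 - t) * U x y) f
      = t * dirichletForm π Q f + (1 - t) * dirichletForm π U f := by
  unfold dirichletForm
  rw [← mul_assoc, ← mul_assoc, mul_comm t, mul_comm (1 - t), mul_assoc, mul_assoc, ← mul_add]
  congr 1
  rw [Finset.mul_sum, Finset.mul_sum, ← Finset.sum_add_distrib]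
  refine sum_congr rfl fun x _ => ?_
  rw [Finset.mul_sum, Finset.mul_sum, ← Finset.sum_add_distrib]
  exact sum_congr rfl fun y _ => by ring

/-- **A move that never changes `f` has `𝓔(f) = 0`.** [ours] -/
theorem dirichletForm_eq_zero_of_invariant (π : X → ℝ) {Q : Matrix X X ℝ} {f : X → ℝ}
    (hQ : ∀ x y, Q x y ≠ 0 → f y = f x) : dirichletForm π Q f = 0 := by
  unfold dirichletForm
  rw [Finset.sum_eq_zero fun x _ => Finset.sum_eq_zero fun y _ => ?_, mul_zero]
  by_cases h : Q x y = 0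
  · rw [h, mul_zero, zero_mul]
  · rw [hQ x y h, sub_self]; ring

/-- A mixture of row-stochastic kernels is row-stochastic (`0 ≤ t ≤ 1`). [ours] -/
theorem isRowStochastic_mixtureFun {Q U : Matrix X X ℝ} (hQ : IsRowStochastic Q) (hU : IsRowStochastic U) {t : ℝ}
    (ht0 : 0 ≤ t) (ht1 : t ≤ 1) : IsRowStochastic (fun x y => t * Q x y + (1 - t) * U x y) := by
  refine ⟨fun x y => add_nonneg (mul_nonneg ht0 (hQ.1 x y)) (mul_nonneg (by linarith) (hU.1 x y)), fun x => ?_⟩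
  simp only
  rw [Finset.sum_add_distrib, ← Finset.mul_sum, ← Finset.mul_sum, hQ.2 x, hU.2 x]
  ring

omit [Fintype X] in
/-- A mixture of `π`-reversible kernels is `π`-reversible. [ours] -/
theorem detailedBalance_mixtureFun {π : X → ℝ} {Q U : Matrix X X ℝ} (hQ : DetailedBalance π Q)
    (hU : DetailedBalance π U) (t : ℝ) : DetailedBalance π (fun x y => t * Q x y + (1 - t) * U x y) := by
  intro x y
  simp only
  rw [mul_add, mul_add, ← mul_assoc, mul_comm (π x) t, mul_assoc, hQ x y, ← mul_assoc (π x), mul_comm (π x) (1 - t),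
    mul_assoc, hU x y]
  ring

end Generic

/-! ## §2 The centred sector count under the product law -/

variable {S : Type*} [Fintype S] [DecidableEq S] {K : ℕ} {μ : Fin (K + 1) → S → ℝ}
  {M : Fin (K + 1) → S → S → ℝ} {t : ℝ}

omit [Fintype S] in
/-- **Increments of the centred count are increments of the raw count:**
`G_A(x) − G_A(y) = #{k : y_k ∈ A} − #{k : x_k ∈ A}` (as reals). [ours] -/
theorem sectorCount_sub_eq [Fintype S] (hμ1 : ∀ k, ∑ u, μ k u = 1) (A : Finset S) (x y : Fin (K + 1) → S) :
    (∑ k, bottleneckTestFun (μ k) A (x k)) - ∑ k, bottleneckTestFun (μ k) A (y k)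
      = (∑ k, (if y k ∈ A then (1 : ℝ) else 0)) - ∑ k, (if x k ∈ A then (1 : ℝ) else 0) := by
  simp_rw [bottleneckTestFun_eq (hμ1 _)]
  rw [Finset.sum_sub_distrib, Finset.sum_sub_distrib]
  have e : ∀ z : Fin (K + 1) → S, ∑ k, (if z k ∈ A then (0 : ℝ) else 1) = (K + 1) - ∑ k, (if z k ∈ A then (1 : ℝ) else 0) := by
    intro z
    have h : ∀ k : Fin (K + 1), (if z k ∈ A then (0 : ℝ) else 1) = 1 - (if z k ∈ A then (1 : ℝ) else 0) := by
      intro k; split_ifs <;> simp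
    simp_rw [h]
    rw [Finset.sum_sub_distrib, Finset.sum_const, Finset.card_univ, Fintype.card_fin, nsmul_eq_mul, mul_one]
    push_cast; ring
  rw [e x, e y]
  ring

omit [DecidableEq S] in
/-- **The centred count is centred under `π̃`.** [ours] -/
theorem tensorFun_mean_sectorCount [DecidableEq S] (hμ1 : ∀ k, ∑ u, μ k u = 1) (A : Finset S) :
    ∑ x : Fin (K + 1) → S, tensorFun μ x * ∑ k, bottleneckTestFun (μ k) A (x k) = 0 := by
  rw [sum_tensorFun_mul_additive μ hμ1]
  exact Finset.sum_eq_zero fun k _ => sum_mul_bottleneckTestFun (μ k) A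

/-- **`‖G_A‖²_π̃ = Σ_k μ_k(A)μ_k(Aᶜ)`.** [ours] -/
theorem tensorFun_piInner_sectorCount (hμ1 : ∀ k, ∑ u, μ k u = 1) (A : Finset S) :
    piInner (tensorFun μ) (fun x => ∑ k, bottleneckTestFun (μ k) A (x k))
        (fun x => ∑ k, bottleneckTestFun (μ k) A (x k))
      = ∑ k, (∑ u ∈ A, μ k u) * ∑ u ∈ Aᶜ, μ k u := by
  rw [piInner_tensorFun_additive μ hμ1 (fun k => bottleneckTestFun (μ k) A) (fun k => sum_mul_bottleneckTestFun (μ k) A)]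
  exact sum_congr rfl fun k _ => piInner_bottleneckTestFun (hμ1 k) A

/-- **The update's Dirichlet form of the count:** `𝓔_π̃(Upd; G_A) = (1/(K+1))Σ_k Q_k(A,Aᶜ)`. [ours] -/
theorem prodUpdate_dirichletForm_sectorCount (hμ1 : ∀ k, ∑ u, μ k u = 1) (hM : ∀ k, IsRowStochastic (M k))
    (hMrev : ∀ k, DetailedBalance (μ k) (M k)) (A : Finset S) :
    dirichletForm (tensorFun μ) (prodKernel (fun _ : Fin (K + 1) => (1 : ℝ) / (K + 1)) M)
        (fun x => ∑ k, bottleneckTestFun (μ k) A (x k))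
      = 1 / (K + 1) * ∑ k, edgeMeasure (μ k) (M k) A Aᶜ := by
  rw [dirichletForm_prodKernel_additive μ hμ1, Finset.mul_sum]
  refine sum_congr rfl fun k _ => ?_
  rw [dirichletForm_bottleneckTestFun (hM k) ((hMrev k).isStationary (hM k).2) (hμ1 k) A]

/-- **An exchange move is invisible to the count:** `Q(x,y) > 0 ⇒ #{y_k ∈ A} = #{x_k ∈ A}` gives
`𝓔_π̃(Q; G_A) = 0`. [ours] -/
theorem exchange_dirichletForm_sectorCount (hμ1 : ∀ k, ∑ u, μ k u = 1) {Q : Matrix (Fin (K + 1) → S) (Fin (K + 1) → S) ℝ}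
    {A : Finset S}
    (hQA : ∀ x y, Q x y ≠ 0 → ∑ k, (if y k ∈ A then (1 : ℝ) else 0) = ∑ k, (if x k ∈ A then (1 : ℝ) else 0)) :
    dirichletForm (tensorFun μ) Q (fun x => ∑ k, bottleneckTestFun (μ k) A (x k)) = 0 := by
  refine dirichletForm_eq_zero_of_invariant _ fun x y hxy => ?_
  have h := sectorCount_sub_eq (μ := μ) hμ1 A y x
  rw [hQA x y hxy, sub_self] at h
  linarith

/-- **The sampler's Dirichlet form of the count: `𝓔_P(G_A) = ((1−t)/(K+1))·Σ_k Q_k(A,Aᶜ)`.** [ours] -/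
theorem mixture_dirichletForm_sectorCount (hμ1 : ∀ k, ∑ u, μ k u = 1) (hM : ∀ k, IsRowStochastic (M k))
    (hMrev : ∀ k, DetailedBalance (μ k) (M k)) {Q : Matrix (Fin (K + 1) → S) (Fin (K + 1) → S) ℝ} {A : Finset S}
    (hQA : ∀ x y, Q x y ≠ 0 → ∑ k, (if y k ∈ A then (1 : ℝ) else 0) = ∑ k, (if x k ∈ A then (1 : ℝ) else 0))
    (t : ℝ) :
    dirichletForm (tensorFun μ)
        (fun x y => t * Q x y + (1 - t) * prodKernel (fun _ : Fin (K + 1) => (1 : ℝ) / (K + 1)) M x y)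
        (fun x => ∑ k, bottleneckTestFun (μ k) A (x k))
      = (1 - t) / (K + 1) * ∑ k, edgeMeasure (μ k) (M k) A Aᶜ := by
  rw [dirichletForm_mixtureFun, exchange_dirichletForm_sectorCount hμ1 hQA,
    prodUpdate_dirichletForm_sectorCount hμ1 hM hMrev, mul_zero, zero_add]
  ring

/-! ## §3 The universal ceiling -/

/-- **NO EXCHANGE SCHEME BEATS THE REPLICAS' OWN TUNNELLING:** for any row-stochastic `π̃`-reversible exchange move
`Q` preserving the number of replicas in `A`, `0 ≤ t ≤ 1`, `|S| ≥ 2` and `Σ_k μ_k(A)μ_k(Aᶜ) > 0`: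
`Gap(tQ + (1−t)Upd) ≤ (1−t)·Σ_k Q_k(A,Aᶜ)/((K+1)·Σ_k μ_k(A)μ_k(Aᶜ))`. [ours] -/
theorem exchangeScheme_spectralGap_le_sectorCount [Nontrivial S] (hμ : ∀ k x, 0 < μ k x)
    (hμ1 : ∀ k, ∑ u, μ k u = 1) (hM : ∀ k, IsRowStochastic (M k)) (hMrev : ∀ k, DetailedBalance (μ k) (M k))
    (ht0 : 0 ≤ t) (ht1 : t ≤ 1) {Q : Matrix (Fin (K + 1) → S) (Fin (K + 1) → S) ℝ} (hQ : IsRowStochastic Q)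
    (hQrev : DetailedBalance (tensorFun μ) Q) {A : Finset S}
    (hQA : ∀ x y, Q x y ≠ 0 → ∑ k, (if y k ∈ A then (1 : ℝ) else 0) = ∑ k, (if x k ∈ A then (1 : ℝ) else 0))
    (hA : 0 < ∑ k, (∑ u ∈ A, μ k u) * ∑ u ∈ Aᶜ, μ k u) :
    spectralGap (tensorFun μ)
        (fun x y => t * Q x y + (1 - t) * prodKernel (fun _ : Fin (K + 1) => (1 : ℝ) / (K + 1)) M x y)
      ≤ (1 - t) * (∑ k, edgeMeasure (μ k) (M k) A Aᶜ) / ((K + 1) * ∑ k, (∑ u ∈ A, μ k u) * ∑ u ∈ Aᶜ, μ k u) := by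
  have hU := prodKernel_isRowStochastic M (fun _ : Fin (K + 1) => (1 : ℝ) / (K + 1)) (fun _ => by positivity)
    (sum_uniform_weight K) hM
  have hUrev := prodKernel_detailedBalance (π := μ) hMrev (fun _ : Fin (K + 1) => (1 : ℝ) / (K + 1))
  have hP := isRowStochastic_mixtureFun hQ hU ht0 ht1
  have hDB := detailedBalance_mixtureFun hQrev hUrev t
  have hray := LevinPeres2017_lemma_13_7_rayleigh (tensorFun_pos hμ) (sum_tensorFun_eq_one μ hμ1) hP hDB
    (tensorFun_mean_sectorCount (μ := μ) hμ1 A)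
  rw [tensorFun_piInner_sectorCount hμ1, mixture_dirichletForm_sectorCount hμ1 hM hMrev hQA] at hray
  rw [le_div_iff₀ (by positivity)]
  have hK1 : (0 : ℝ) < K + 1 := by positivity
  calc spectralGap (tensorFun μ)
        (fun x y => t * Q x y + (1 - t) * prodKernel (fun _ : Fin (K + 1) => (1 : ℝ) / (K + 1)) M x y)
        * ((K + 1) * ∑ k, (∑ u ∈ A, μ k u) * ∑ u ∈ Aᶜ, μ k u)
      = (K + 1) * (spectralGap (tensorFun μ)
          (fun x y => t * Q x y + (1 - t) * prodKernel (fun _ : Fin (K + 1) => (1 : ℝ) / (K + 1)) M x y)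
          * ∑ k, (∑ u ∈ A, μ k u) * ∑ u ∈ Aᶜ, μ k u) := by ring
    _ ≤ (K + 1) * ((1 - t) / (K + 1) * ∑ k, edgeMeasure (μ k) (M k) A Aᶜ) := mul_le_mul_of_nonneg_left hray hK1.le
    _ = (1 - t) * ∑ k, edgeMeasure (μ k) (M k) A Aᶜ := by field_simp

/-- **ONE TUNNELLING REPLICA CAPS EVERY EXCHANGE SCHEME AT ORDER `K²`:** sector-frozen cold replicas
(`Q_k(A,Aᶜ) = 0`, `μ_k(A)μ_k(Aᶜ) ≥ v > 0` for `k ≥ 1`, `K ≥ 1`) and any count-preserving exchange move: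
`Gap(tQ + (1−t)Upd) ≤ (1−t)·Q_0(A,Aᶜ)/((K+1)·K·v)`. [ours] -/
theorem exchangeScheme_spectralGap_le_hot [Nontrivial S] (hK : 1 ≤ K) (hμ : ∀ k x, 0 < μ k x)
    (hμ1 : ∀ k, ∑ u, μ k u = 1) (hM : ∀ k, IsRowStochastic (M k)) (hMrev : ∀ k, DetailedBalance (μ k) (M k))
    (ht0 : 0 ≤ t) (ht1 : t ≤ 1) {Q : Matrix (Fin (K + 1) → S) (Fin (K + 1) → S) ℝ} (hQ : IsRowStochastic Q)
    (hQrev : DetailedBalance (tensorFun μ) Q) {A : Finset S}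
    (hQA : ∀ x y, Q x y ≠ 0 → ∑ k, (if y k ∈ A then (1 : ℝ) else 0) = ∑ k, (if x k ∈ A then (1 : ℝ) else 0))
    {v : ℝ} (hvpos : 0 < v) (hv : ∀ k : Fin (K + 1), k ≠ 0 → v ≤ (∑ u ∈ A, μ k u) * ∑ u ∈ Aᶜ, μ k u)
    (hfrozen : ∀ k : Fin (K + 1), k ≠ 0 → edgeMeasure (μ k) (M k) A Aᶜ = 0) :
    spectralGap (tensorFun μ)
        (fun x y => t * Q x y + (1 - t) * prodKernel (fun _ : Fin (K + 1) => (1 : ℝ) / (K + 1)) M x y)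
      ≤ (1 - t) * edgeMeasure (μ 0) (M 0) A Aᶜ / ((K + 1) * (K * v)) := by
  have hKpos : (0 : ℝ) < K := Nat.cast_pos.mpr (by omega)
  -- `Σ_k μ_k(A)μ_k(Aᶜ) ≥ K·v`
  have hVge : (K : ℝ) * v ≤ ∑ k : Fin (K + 1), (∑ u ∈ A, μ k u) * ∑ u ∈ Aᶜ, μ k u := by
    rw [Fin.sum_univ_succ]
    have h0 : 0 ≤ (∑ u ∈ A, μ 0 u) * ∑ u ∈ Aᶜ, μ 0 u :=
      mul_nonneg (sum_nonneg fun u _ => (hμ _ u).le) (sum_nonneg fun u _ => (hμ _ u).le)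
    have h1 : (K : ℝ) * v ≤ ∑ j : Fin K, (∑ u ∈ A, μ j.succ u) * ∑ u ∈ Aᶜ, μ j.succ u :=
      calc (K : ℝ) * v = ∑ _j : Fin K, v := by
            rw [Finset.sum_const, Finset.card_univ, Fintype.card_fin, nsmul_eq_mul]
        _ ≤ _ := sum_le_sum fun j _ => hv j.succ (Fin.succ_ne_zero j)
    linarith
  have hA : 0 < ∑ k, (∑ u ∈ A, μ k u) * ∑ u ∈ Aᶜ, μ k u := lt_of_lt_of_le (mul_pos hKpos hvpos) hVge
  have h := exchangeScheme_spectralGap_le_sectorCount (t := t) (M := M) hμ hμ1 hM hMrev ht0 ht1 hQ hQrev hQA hA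
  have hQ : ∑ k : Fin (K + 1), edgeMeasure (μ k) (M k) A Aᶜ = edgeMeasure (μ 0) (M 0) A Aᶜ := by
    rw [Finset.sum_eq_single (0 : Fin (K + 1)) (fun k _ hk => hfrozen k hk) (fun h => absurd (mem_univ _) h)]
  rw [hQ] at h
  have hQ0 : 0 ≤ (1 - t) * edgeMeasure (μ 0) (M 0) A Aᶜ := by
    refine mul_nonneg (by linarith) ?_
    unfold edgeMeasure
    exact sum_nonneg fun x _ => sum_nonneg fun y _ => mul_nonneg (hμ 0 x).le ((hM 0).1 x y)
  calc spectralGap (tensorFun μ)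
        (fun x y => t * Q x y + (1 - t) * prodKernel (fun _ : Fin (K + 1) => (1 : ℝ) / (K + 1)) M x y) ≤ _ := h
    _ ≤ (1 - t) * edgeMeasure (μ 0) (M 0) A Aᶜ / ((K + 1) * (K * v)) :=
        div_le_div_of_nonneg_left hQ0 (by positivity) (mul_le_mul_of_nonneg_left hVge (by positivity))

end Summit.Ventures.LatticeQCDFlow.Scaling

end
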